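import Summits.RiemannHypothesis.RiemannHypothesis.Theorems.TiltedLandingLaw421R3Lens1ArcSignN
import Summits.RiemannHypothesis.RiemannHypothesis.Theorems.TiltedLandingLaw421R3Lens1PinningTol

/-!
# TiltedLandingLaw421R3 — lens-1: «LinkTol» — the nodal link re-confined to TWO discs, OR THE BASE ⇒ registry stub 1′ (K + M-small + one re-run of part N §3)

LENS-1 gen-10 image v5 (= v4 minus the (K) copy, (CA1157); (CA1138)(1)/(CA1144): slot 160 «Lens1LinkTol»;
landing target `…/Theorems/TiltedLandingLaw421R3Lens1LinkTol.lean`; the NEXT TYPABLE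
OBJECT on the (G1)/part-N line asked by (CA1133)(4)).  TWO tree imports: part N `…R3Lens1ArcSignN` (#1202: `phiAt`, `LinkCore`, `LeftSign`, `HalfLink`,
`TopLinkLawQ`, the PROVED link analysis `norm_logDeriv_large_near` / `exists_eq_zero_of_link` / `pinning_of_halfLink`) and #1256 `…R3Lens1PinningTol`
(`TopPinningTol θ` = registry stub 1′, `PinnedTopAt`).  Namespace `RhW08.Lens1LinkTol`; 0 sorry; no instance / notation / set_option.

WHY.  Part N's ∀-law `TopLinkLawQ` implies `TopPinning` (`topPinning_of_topLinkLaw`), and `TopPinning` is DEAD AS TYPED (NEG 16, the exact equal-height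
wall EQH-231-1864: at `T = i` the cluster critical point `0.12722 + 0.99188 i` misses `T`'s closed disc by `1.1·10⁻⁵` and the NL event `x = −1.00047` misses
the closed base by `4.7·10⁻⁴`) — so `TopLinkLawQ` is dead as typed too (modus tollens): on that frame `T = i` is a STRANGLED top in part N's sense.
But the same critical point is NESTED under the equal-height partner `b = 0.231 + i` (`|w − Re b|² = 0.9946 ≤ 1`): the chain of `∂F_T` out of `T` pays —
in `b`'s disc.  The registry's repaired stub 1′ `TopPinningTol (1/10)` asks exactly for pinning at `T` OR at a θ-partner.  And when the mates sit just
BELOW the θ-band (two-sided SUB-BAND wall, lens-1 g10 `link2/scan3`: 69/300 rows) they capture BOTH chains sideways before the feet, no partner disc is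
admissible — and `T` is pinned instead by an NL event UNDER ITSELF (675/675 window tilts): the BASE of the cycle pays.  THE LONE-PAIR IDENTITY explains
both: for the pair alone `1/(z − T) + 1/(z − T̄) = 1/(Re z − Re T)` on `T`'s Jensen circle (`pairPhi_eq_on_circle`, PROVED) — the circle ∪ the base is
a closed nodal cycle of `Im φ` carrying `Re φ` once through every real level; the rest of the logarithmic derivative only deforms it (arc pushed into a
mate's disc, or chains captured and the base left to pay).  Hence the re-target to the CYCLE (chains confined to two discs, or the base):

* `LinkCoreIn f j D σ S` / `HalfLinkIn f j a D` = part N's `LinkCore` / `HalfLink` with the disc clause `NestedStep a (σ s)` replaced by CONFINEMENT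
  `σ s ∈ D` to an arbitrary region `D` (`halfLinkIn_jDisc_iff : HalfLinkIn f j a (jDisc a) ↔ HalfLink f j a` is `Iff.rfl`);
* ★ `exists_crit_path_of_linkCoreIn` (PROVED, PATH FORM = the primary statement, (CA1147)(2)): along a confined link path out of a SIMPLE zero `a` some
  parameter `t ∈ (0, s₂]` has `f⁽ʲ⁺¹⁾ (σ t) = 0` — the zero lies ON THE PATH (part N §2 re-run with the region abstract); its corollary
  ★ `exists_crit_of_halfLinkIn`: a confined half-link passes a zero `z ∈ D` of `f⁽ʲ⁺¹⁾`, off the axis or an NL event on it (true on base-NL rows —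
  refutation files use the path form);
* the ONE-DISC case is CITED, not restated: part N's landed `RhW08.Lens1ArcSign.pinning_of_halfLink` (#1202) is the `D = jDisc a` instance of
  ★ `exists_crit_of_halfLinkIn` + `pinnedTopAt_of_mem_jDisc` (desk note (CA1138)(4); no copy here — gate `dedup.landed`, (CA1157));
* `HalfLink₂ f j a a' := HalfLinkIn f j a (jDisc a ∪ jDisc a')` (TWO-DISC half-link) and ★ `pinning_of_halfLink₂` (PROVED): it pays `PinnedTopAt f j a ∨
  PinnedTopAt f j a'`;
* ★ `pairPhi_eq_on_circle` / `im_pairPhi_eq_zero_on_circle` (PROVED, M-small): the lone-pair identity above;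
* ★ the law `TopLinkOrBaseLawQ θ` (OPEN, UNDECIDED): every SIMPLE, NON-ISOLATED upper zero `a` with no taller toucher EITHER has a zero `a'` of `f⁽ʲ⁾` in
  the θ-band `(1 − θ)·Im a ≤ Im a' ≤ Im a`, disc-touching (`|Re a − Re a'| ≤ Im a + Im a'`, `a' = a` allowed), with `HalfLink₂ f j a a'`, OR an NL event
  of `f⁽ʲ⁾` in its closed base `|x − Re a| ≤ Im a`; the LINK-ONLY variant (first alternative alone) is declared BY NAME as `TopLinkLawTolQ θ` for the
  record ((CA1144)(b)): FLOAT-DEAD as typed at θ = 1/10 on the sub-band wall, exact witness pending C6 g47 — so that an exact (A′) row can land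
  `¬ TopLinkLawTolQ (1/10)` by name; `topLinkOrBaseLaw_of_topLinkLawTol : TopLinkLawTolQ θ → TopLinkOrBaseLawQ θ` (K);
* ★★ `topPinningTol_of_topLinkOrBaseLaw : 0 ≤ θ → TopLinkOrBaseLawQ θ → TopPinningTol θ` (PROVED (K): isolated tops by IsoB
  `pinning_of_jensenIsolated'`, multiple tops are their own child, the rest by the law + `pinning_of_halfLink₂` / the base event) — a ONE-LAW sufficient
  condition for REGISTRY STUB 1′ at θ = 1/10 (`stub1'_of_topLinkOrBaseLaw`);
* `topLinkOrBaseLaw_of_topLinkLaw : 0 ≤ θ → TopLinkLawQ → TopLinkOrBaseLawQ θ` (K; part N's dead law is the `a' = a` instance — bookkeeping only).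
HONEST COSTUME NOTE: the base alternative IS the second disjunct of `PinnedTopAt f j a` verbatim; the law's content beyond stub 1′ lies in the first
alternative only — «a base-silent top is LINKED: the critical point that pins it (or its band partner) is reached from `a` by a confined nodal chain».

WHY IT MIGHT FAIL («base-silent doubly strangled top»): both chains of `∂F_a` leave `D̄_a ∪ D̄_{a'}` for EVERY admissible partner `a'` before `Re φ`
changes sign AND the base carries no NL event at that level — wanted: side mates capturing both chains while a tooth / low pair under `a` kills the
base slope (floats so far: a tooth under a walled top RELEASES the chains instead, 0/600 windows).
Census of record FOR the one-disc link: C6 g39 LINK TRACE 1 163/1 163 bank tops at every tilt (both-exit 0), lens-1 g8 linkscan 2 404/2 404, advlink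
sup W = −0.156 (no strangled top with an interior mate); AGAINST it: NEG 16 (no interior mate; partner outside the closed disc at equal height).
Census (floats, bus record, lens-1 g10 `link2/`): two-disc LINK alone — NEG 16 itself pays in `b`'s disc (κ = −1) and in `c = −1.864 + i`'s disc (κ = +1);
in-band EQH wall family 0/150 failing windows (one-disc: 13/150); walsh8 climb bottoms 0/18; but two-sided SUB-BAND wall 69/300 FAILING (link-only dead as
typed) — LINK-OR-BASE: 0 failures at 675/675 window tilts of those rows (base NL every time), tooth-under-top families 0/600 windows; C6 g47's bench
«LINK TRACE 2-DISC» (+ population (A′) sub-band) is the bench of record.  A census decides nothing.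

HONEST LABEL: definitions + (K) glue + one identity + one re-run of part N's proved analysis; the law `TopLinkOrBaseLawQ θ` is OPEN and asserted by
nothing; `TopPinningTol`,
stubs 1′/2/2′/3, 33346/33347 OPEN; nothing here bears on the truth of RH; RH is not proved; checked ≠ keyed ≠ landed ≠ proved.
-/

noncomputable section

namespace RhW08.Lens1LinkTol

open Complex Set Metric Filter Topology
open scoped Real ComplexConjugate
open Literature.Topology.PlaneTopology Literature.Analysis.Complex
open Summit.RiemannHypothesis.RiemannHypothesis.Theorems.Splittings.JensenWindow
open RhIdea6.G17.W07C7 RhIdea6.G17.W07C7.Rev6 RhIdea6.G18.W07C8.Law421BirthS RhIdea6.G19.W07C11.Seam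
open RhIdea6.G20.W07C12.Frac RhIdea6.G20.W07C12.StColP RhW07.C12.FieldSplit RhIdea6.G21.W07C13.TentMax
open RhW07.C14.TwoSided RhW07.C14.Classes RhW07.C14.Lineage RhW07.C14.Booking
open RhW07.C13.Heredity RhIdea6.G22.W07C15pre.Injection RhW07.E3.Cell RhW07.E3.Lit
open RhW08.Round1 RhW08.StSwap RhW08.Round2 RhW08.QuadW RhW08.SealSwapQ RhW08.SealSwap RhW08.SuccB RhW08.SuccSplit
open RhW08.SuccTheft RhW08.Column RhW08.Hurwitz RhW08.ClusterQ RhW08.ClusterQM RhW08.NewtonDoor RhW08.NewtonDoorGenusOne RhW08.PurseP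
open RhW08.Lens1SignCut RhW08.Lens1Coverage RhW08.IsolatedTilt RhW08.Lens1Pinning RhW08.Lens1PinningIso
open RhW08.Lens1ArcSign RhW08.Lens1TopChild RhW08.Lens1PinningTol

/-! ## §1 Confined link paths (part N's clauses with an abstract region) -/

/-- The CLOSED Jensen disc of `a` as a set: `{z | (Re z − Re a)² + (Im z)² ≤ (Im a)²}` = `{z | NestedStep a z}`. -/
def jDisc (a : ℂ) : Set ℂ := {z | NestedStep a z}

/-- LINK CORE CLAUSES CONFINED TO `D`: part N's `LinkCore` with `NestedStep a (σ s)` replaced by `σ s ∈ D` (closed upper half-plane, off the zeros of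
`f⁽ʲ⁾`, nodal for `Im φ`, Laguerre-violating at axis points — all verbatim). -/
def LinkCoreIn (f : ℂ → ℂ) (j : ℕ) (D : Set ℂ) (σ : ℝ → ℂ) (S : Set ℝ) : Prop :=
  ∀ s ∈ S, σ s ∈ D ∧ 0 ≤ (σ s).im ∧ iteratedDeriv j f (σ s) ≠ 0 ∧ (phiAt f j (σ s)).im = 0 ∧
    ((σ s).im = 0 → 0 ≤ (iteratedDeriv j f (σ s)).re * (iteratedDeriv (j + 2) f (σ s)).re)

/-- HALF-LINK of the zero `a` CONFINED TO `D`: part N's `HalfLink` with `LinkCoreIn f j D` for `LinkCore f j a`. -/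
def HalfLinkIn (f : ℂ → ℂ) (j : ℕ) (a : ℂ) (D : Set ℂ) : Prop :=
  ∃ κ : ℝ, (κ = 1 ∨ κ = -1) ∧ ∃ σ σ' : ℝ → ℂ, σ 0 = a ∧ (∀ s ∈ Icc (0 : ℝ) 1, HasDerivAt σ (σ' s) s) ∧
    LinkCoreIn f j D σ (Ioo 0 1) ∧ LeftSign f j σ σ' κ (Ioo 0 1) ∧ ∃ s₂ ∈ Ioo (0 : ℝ) 1, 0 ≤ κ * (phiAt f j (σ s₂)).re

/-- ★ TWO-DISC HALF-LINK: the chain may run in `a`'s OR in `a'`'s closed Jensen disc. -/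
def HalfLink₂ (f : ℂ → ℂ) (j : ℕ) (a a' : ℂ) : Prop := HalfLinkIn f j a (jDisc a ∪ jDisc a')

/-- Consistency with part N: confinement to `a`'s own disc IS `LinkCore`. -/
theorem linkCoreIn_jDisc_iff {f : ℂ → ℂ} {j : ℕ} {a : ℂ} {σ : ℝ → ℂ} {S : Set ℝ} : LinkCoreIn f j (jDisc a) σ S ↔ LinkCore f j a σ S := Iff.rfl

/-- Consistency with part N: `HalfLinkIn … (jDisc a)` IS `HalfLink`. -/
theorem halfLinkIn_jDisc_iff {f : ℂ → ℂ} {j : ℕ} {a : ℂ} : HalfLinkIn f j a (jDisc a) ↔ HalfLink f j a := Iff.rfl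

/-- Confinement is monotone in the region. -/
theorem halfLinkIn_mono {f : ℂ → ℂ} {j : ℕ} {a : ℂ} {D D' : Set ℂ} (hD : D ⊆ D') (h : HalfLinkIn f j a D) : HalfLinkIn f j a D' := by
  obtain ⟨κ, hκ, σ, σ', h0, hσ, hcore, hsign, s₂, hs₂, hpos⟩ := h
  exact ⟨κ, hκ, σ, σ', h0, hσ, fun s hs => ⟨hD (hcore s hs).1, (hcore s hs).2⟩, hsign, s₂, hs₂, hpos⟩

/-- A one-disc half-link is a two-disc half-link with any partner (in particular `a' = a`). -/
theorem halfLink₂_of_halfLink {f : ℂ → ℂ} {j : ℕ} {a : ℂ} (a' : ℂ) (h : HalfLink f j a) : HalfLink₂ f j a a' :=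
  halfLinkIn_mono subset_union_left (halfLinkIn_jDisc_iff.mpr h)

/-- … and `HalfLink₂ f j a a` is `HalfLink f j a`. -/
theorem halfLink₂_self_iff {f : ℂ → ℂ} {j : ℕ} {a : ℂ} : HalfLink₂ f j a a ↔ HalfLink f j a := by
  unfold HalfLink₂; rw [union_self]; exact halfLinkIn_jDisc_iff

/-! ## §2 The confined link pays inside its region (part N §3 re-run with `D` abstract) -/

/-- The four abstract hypotheses of part N §2 for `ψ = κ · φ` along a CONFINED link path. -/
theorem link_hypsIn {η : ℝ} {f : ℂ → ℂ} {x₀ s hmax R Hs : ℝ} {B : ℕ} (hE : EngineHyps5 2 η f x₀ s hmax R Hs B) {j : ℕ} {D : Set ℂ}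
    {κ : ℝ} (hκ : κ = 1 ∨ κ = -1) {σ σ' : ℝ → ℂ} (hcore : LinkCoreIn f j D σ (Ioo 0 1)) (hsign : LeftSign f j σ σ' κ (Ioo 0 1)) :
    (∀ s ∈ Ioo (0 : ℝ) 1, DifferentiableAt ℂ (fun z => (κ : ℂ) * phiAt f j z) (σ s)) ∧
    (∀ s ∈ Ioo (0 : ℝ) 1, ((fun z => (κ : ℂ) * phiAt f j z) (σ s)).im = 0) ∧
    (∀ s ∈ Ioo (0 : ℝ) 1, ∃ ε₀ : ℝ, 0 < ε₀ ∧ ∀ ε ∈ Ioo (0 : ℝ) ε₀,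
      0 ≤ ((fun z => (κ : ℂ) * phiAt f j z) (σ s + (ε : ℂ) * (I * σ' s))).im) ∧
    (∀ z : ℂ, ‖(fun z => (κ : ℂ) * phiAt f j z) z‖ = ‖deriv (iteratedDeriv j f) z / iteratedDeriv j f z‖) := by
  have hG : RealEntireLt2 (iteratedDeriv j f) := RhW08.WindowLoss.realEntireLt2_iteratedDeriv (realEntireLt2_of_hyps hE) j
  have hG'd := differentiable_deriv_iteratedDeriv hE j
  have hκ1 : ‖(κ : ℂ)‖ = 1 := by rcases hκ with rfl | rfl <;> simp
  refine ⟨fun s hs => ?_, fun s hs => ?_, fun s hs => ?_, fun z => ?_⟩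
  · exact (((hG'd _).div (hG.diff _) (hcore s hs).2.2.1).const_mul (κ : ℂ))
  · simp [(hcore s hs).2.2.2.1]
  · obtain ⟨ε₀, hε₀, h⟩ := hsign s hs
    exact ⟨ε₀, hε₀, fun ε hε => by simpa [Complex.im_ofReal_mul] using h ε hε⟩
  · simp only [norm_mul, hκ1, one_mul]; rfl

/-- ★ PATH FORM (PROVED; the primary statement — a refutation file contradicts THIS, not the corollary below): along a CONFINED link path out of a
SIMPLE zero `a` of `f⁽ʲ⁾` (core clauses in `D`, one-sided sign, a point `s₂` with `0 ≤ κ·Re φ`), some parameter `t ∈ (0, s₂]` carries a zero of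
`f⁽ʲ⁺¹⁾` ON THE PATH: `f⁽ʲ⁺¹⁾ (σ t) = 0` (part N §2: blow-up at `a`, IVT, `isMaxOn` — `exists_eq_zero_of_link`). -/
theorem exists_crit_path_of_linkCoreIn {η : ℝ} {f : ℂ → ℂ} {x₀ s hmax R Hs : ℝ} {B : ℕ} (hE : EngineHyps5 2 η f x₀ s hmax R Hs B)
    {j : ℕ} {a : ℂ} {D : Set ℂ} {κ : ℝ} {σ σ' : ℝ → ℂ} {s₂ : ℝ} (ha : iteratedDeriv j f a = 0) (hda : iteratedDeriv (j + 1) f a ≠ 0)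
    (hκ : κ = 1 ∨ κ = -1) (hσ0 : σ 0 = a) (hσ : ∀ s ∈ Icc (0 : ℝ) 1, HasDerivAt σ (σ' s) s) (hcore : LinkCoreIn f j D σ (Ioo 0 1))
    (hsign : LeftSign f j σ σ' κ (Ioo 0 1)) (hs₂ : s₂ ∈ Ioo (0 : ℝ) 1) (hpos : 0 ≤ κ * (phiAt f j (σ s₂)).re) :
    ∃ t ∈ Ioc (0 : ℝ) s₂, iteratedDeriv (j + 1) f (σ t) = 0 := by
  classical
  have hG : RealEntireLt2 (iteratedDeriv j f) := RhW08.WindowLoss.realEntireLt2_iteratedDeriv (realEntireLt2_of_hyps hE) j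
  have hG'd := differentiable_deriv_iteratedDeriv hE j
  have e1 : deriv (iteratedDeriv j f) = iteratedDeriv (j + 1) f := by rw [← iteratedDeriv_succ]
  have hκ0 : (κ : ℂ) ≠ 0 := by rcases hκ with rfl | rfl <;> simp
  obtain ⟨hψd, hnodal, hleft, hnorm⟩ := link_hypsIn hE hκ hcore hsign
  have hne : ∀ s ∈ Ioo (0 : ℝ) 1, iteratedDeriv j f (σ s) ≠ 0 := fun s hs => (hcore s hs).2.2.1
  have hblow : ∀ M : ℝ, ∃ δ : ℝ, 0 < δ ∧ ∀ s ∈ Ioo (0 : ℝ) 1, s < δ → M < ‖(fun z => (κ : ℂ) * phiAt f j z) (σ s)‖ := by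
    intro M
    obtain ⟨δ, hδ, h⟩ := norm_logDeriv_large_near hG.diff hG'd ha (by rwa [e1]) (hσ 0 ⟨le_rfl, zero_le_one⟩).continuousAt hσ0 M
    exact ⟨δ, hδ, fun s hs hsδ => by rw [hnorm]; exact h s (by rwa [sub_zero, abs_of_pos hs.1]) (hne s hs)⟩
  have hpos' : 0 ≤ ((fun z => (κ : ℂ) * phiAt f j z) (σ s₂)).re := by simpa [Complex.re_ofReal_mul] using hpos
  obtain ⟨t, ht, hψ0⟩ := exists_eq_zero_of_link hσ hψd hnodal hleft hblow hs₂ hpos'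
  have htI : t ∈ Ioo (0 : ℝ) 1 := ⟨ht.1, ht.2.trans_lt hs₂.2⟩
  have hGne := (hcore t htI).2.2.1
  have hφ0 : phiAt f j (σ t) = 0 := (mul_eq_zero.mp hψ0).resolve_left hκ0
  refine ⟨t, ht, ?_⟩
  unfold phiAt at hφ0
  have := (div_eq_zero_iff.mp hφ0).resolve_right hGne
  rwa [e1] at this

/-- ★ THE CONFINED LINK PAYS IN ITS REGION (COROLLARY of the path form): on a legal frame, a half-link out of a SIMPLE upper zero `a` of `f⁽ʲ⁾`
confined to `D` passes a point `z ∈ D` with `f⁽ʲ⁺¹⁾ z = 0`, which is off the axis or an NL event on it.  (On a row whose base carries an NL event this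
disjunction is TRUE — refutations use `exists_crit_path_of_linkCoreIn`.) -/
theorem exists_crit_of_halfLinkIn {η : ℝ} {f : ℂ → ℂ} {x₀ s hmax R Hs : ℝ} {B : ℕ} (hE : EngineHyps5 2 η f x₀ s hmax R Hs B)
    {j : ℕ} {a : ℂ} {D : Set ℂ} (ha : iteratedDeriv j f a = 0) (hda : iteratedDeriv (j + 1) f a ≠ 0) (hL : HalfLinkIn f j a D) :
    ∃ z ∈ D, iteratedDeriv (j + 1) f z = 0 ∧ (z.im ≠ 0 ∨ (z.im = 0 ∧ NLEventOf f j z.re)) := by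
  classical
  have hG : RealEntireLt2 (iteratedDeriv j f) := RhW08.WindowLoss.realEntireLt2_iteratedDeriv (realEntireLt2_of_hyps hE) j
  obtain ⟨κ, hκ, σ, σ', hσ0, hσ, hcore, hsign, s₂, hs₂, hpos⟩ := hL
  obtain ⟨t, ht, hzero⟩ := exists_crit_path_of_linkCoreIn hE ha hda hκ hσ0 hσ hcore hsign hs₂ hpos
  have htI : t ∈ Ioo (0 : ℝ) 1 := ⟨ht.1, ht.2.trans_lt hs₂.2⟩
  obtain ⟨hmem, -, hGne, -, hchord⟩ := hcore t htI
  refine ⟨σ t, hmem, hzero, ?_⟩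
  by_cases hw : (σ t).im = 0
  · right
    have hx : (((σ t).re : ℝ) : ℂ) = σ t := Complex.ext (by simp) (by simp [hw])
    have hGim : (iteratedDeriv j f (σ t)).im = 0 := by rw [← hx]; exact hG.real _
    refine ⟨hw, by rw [hx, hzero, Complex.zero_re], fun h0 => hGne ?_, by rw [hx]; exact hchord hw⟩
    rw [hx] at h0
    exact Complex.ext (by simpa using h0) (by simpa using hGim)
  · exact Or.inl hw

/-- (K) a critical point / NL event found inside `c`'s closed Jensen disc pins `c` (`0 ≤ Im c` places the axis point in the closed base). -/
theorem pinnedTopAt_of_mem_jDisc {f : ℂ → ℂ} {j : ℕ} {c z : ℂ} (hc : 0 ≤ c.im) (hz : z ∈ jDisc c) (hzero : iteratedDeriv (j + 1) f z = 0)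
    (halt : z.im ≠ 0 ∨ (z.im = 0 ∧ NLEventOf f j z.re)) : PinnedTopAt f j c := by
  rcases halt with hw | ⟨hw, hNL⟩
  · exact Or.inl ⟨z, hzero, hw, hz⟩
  · right
    refine ⟨z.re, ?_, hNL⟩
    have h1 : (z.re - c.re) ^ 2 + z.im ^ 2 ≤ c.im ^ 2 := hz
    rw [hw] at h1
    exact abs_le_of_sq_le_sq (by nlinarith) hc

/-- ★ THE TWO-DISC LINK PAYS (PROVED): `a` or the partner `a'` is pinned. -/
theorem pinning_of_halfLink₂ {η : ℝ} {f : ℂ → ℂ} {x₀ s hmax R Hs : ℝ} {B : ℕ} (hE : EngineHyps5 2 η f x₀ s hmax R Hs B)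
    {j : ℕ} {a a' : ℂ} (ha : iteratedDeriv j f a = 0) (hapos : 0 < a.im) (hda : iteratedDeriv (j + 1) f a ≠ 0) (ha' : 0 ≤ a'.im)
    (hL : HalfLink₂ f j a a') : PinnedTopAt f j a ∨ PinnedTopAt f j a' := by
  obtain ⟨z, hz, hzero, halt⟩ := exists_crit_of_halfLinkIn hE ha hda hL
  rcases hz with hz | hz
  · exact Or.inl (pinnedTopAt_of_mem_jDisc hapos.le hz hzero halt)
  · exact Or.inr (pinnedTopAt_of_mem_jDisc ha' hz hzero halt)

/-! ## §3 The lone-pair identity (why circle ∪ base is the natural cycle) -/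

/-- ★ THE LONE-PAIR IDENTITY (PROVED): on `a`'s Jensen circle `(Re z − Re a)² + (Im z)² = (Im a)²`, off the vertical through `a`, the pair's
logarithmic derivative is `1/(z − a) + 1/(z − ā) = 1/(Re z − Re a)` — in particular REAL: for the lone pair the circle together with the base
`[Re a − Im a, Re a + Im a]` is a closed nodal cycle of `Im φ` carrying `Re φ` once through every real level (west arc `−∞ → −1/Im a`, base
`−1/Im a → 1/Im a` with slope `≥ 0`, east arc `1/Im a → +∞`); the rest of the logarithmic derivative only deforms this cycle (module docstring). -/
theorem pairPhi_eq_on_circle {a z : ℂ} (hz : (z.re - a.re) ^ 2 + z.im ^ 2 = a.im ^ 2) (hre : z.re ≠ a.re) :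
    1 / (z - a) + 1 / (z - conj a) = 1 / ((z.re - a.re : ℝ) : ℂ) := by
  have h1 : z - a ≠ 0 := fun h => hre (by simpa [sub_eq_zero] using congrArg Complex.re h)
  have h2 : z - conj a ≠ 0 := fun h => hre (by simpa [sub_eq_zero] using congrArg Complex.re h)
  have h3 : ((z.re - a.re : ℝ) : ℂ) ≠ 0 := by exact_mod_cast sub_ne_zero.mpr hre
  rw [div_add_div _ _ h1 h2, div_eq_div_iff (mul_ne_zero h1 h2) h3]
  apply Complex.ext
  · simp only [Complex.mul_re, Complex.mul_im, Complex.add_re, Complex.add_im, Complex.sub_re, Complex.sub_im, Complex.one_re, Complex.one_im,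
      Complex.conj_re, Complex.conj_im, Complex.ofReal_re, Complex.ofReal_im]
    nlinarith [hz]
  · simp only [Complex.mul_re, Complex.mul_im, Complex.add_re, Complex.add_im, Complex.sub_re, Complex.sub_im, Complex.one_re, Complex.one_im,
      Complex.conj_re, Complex.conj_im, Complex.ofReal_re, Complex.ofReal_im]
    nlinarith [hz]

/-- … hence `Im (1/(z − a) + 1/(z − ā)) = 0` on the circle (off the vertical through `a`). -/
theorem im_pairPhi_eq_zero_on_circle {a z : ℂ} (hz : (z.re - a.re) ^ 2 + z.im ^ 2 = a.im ^ 2) (hre : z.re ≠ a.re) :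
    (1 / (z - a) + 1 / (z - conj a)).im = 0 := by
  rw [pairPhi_eq_on_circle hz hre, ← Complex.ofReal_one, ← Complex.ofReal_div, Complex.ofReal_im]

/-! ## §4 The law and its wiring to registry stub 1′ -/

/-- THE LINK-ONLY TWO-DISC LAW `TopLinkLawTolQ θ` (declared BY NAME for the record, (CA1144)(b)): on a legal frame, every SIMPLE, NON-ISOLATED upper
zero `a` of `f⁽ʲ⁾` with no taller toucher has a disc-touching partner `a'` in the θ-band below it (possibly `a' = a`) with `HalfLink₂ f j a a'`.
STATUS: FLOAT-DEAD AS TYPED at θ = 1/10 on the two-sided SUB-BAND wall family (lens-1 g10 `link2/scan3` a69e9be8: failing window nonempty in 69/300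
rows — mates just below the band capture both chains sideways and no partner disc is admissible; `a` is then pinned by an NL event under itself);
exact witness pending C6 g47 (an exact (A′) row lands `¬ TopLinkLawTolQ (1/10)` by name).  Asserted by nothing here; it is the first alternative of
`TopLinkOrBaseLawQ θ` (`topLinkOrBaseLaw_of_topLinkLawTol`). -/
def TopLinkLawTolQ (θ : ℝ) : Prop :=
  ∀ (η : ℝ) (f : ℂ → ℂ) (x₀ s hmax R Hs : ℝ) (B : ℕ), EngineHyps5 2 η f x₀ s hmax R Hs B → ∀ (j : ℕ) (a : ℂ),
    iteratedDeriv j f a = 0 → 0 < a.im → NoTallerToucher f j a → ¬ JensenIsolated f j a → iteratedDeriv (j + 1) f a ≠ 0 →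
    ∃ a' : ℂ, iteratedDeriv j f a' = 0 ∧ (1 - θ) * a.im ≤ a'.im ∧ a'.im ≤ a.im ∧ 0 < a'.im ∧ |a.re - a'.re| ≤ a.im + a'.im ∧ HalfLink₂ f j a a'

/-- ★ THE LINK-OR-BASE LAW (OPEN, UNDECIDED; re-target of part N's `TopLinkLawQ` past NEG 16 and of the link-only `TopLinkLawTolQ` past the
sub-band wall): on a legal frame, every SIMPLE upper zero `a` of `f⁽ʲ⁾` with no taller toucher and SOME Jensen mate EITHER has a disc-touching partner `a'`
in the θ-band below it (possibly `a' = a`) such that a chain of the nodal set of `Im (f⁽ʲ⁺¹⁾/f⁽ʲ⁾)` out of `a`, positive face on one side, reaches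
`κ·Re φ ≥ 0` before leaving `D̄_a ∪ D̄_{a'}` (the ARC part of the cycle, deformed), OR has an NL event of `f⁽ʲ⁾` in its closed base (the BASE part).
HONEST COSTUME NOTE: the second disjunct IS the second disjunct of `PinnedTopAt f j a` verbatim — the law's content over stub 1′ lives in the first
disjunct only: «every nested critical point that pins a base-silent top is LINKED to the top by a confined nodal chain» (strictly stronger than
stub 1′ there, not implied by `TopPinningTol`).  WHY IT MIGHT FAIL: a base-silent doubly-strangled top — side mates capturing both chains while a
tooth / low pair under `a` kills the base slope (module docstring).  Source: Sheil-Small, Complex Polynomials §9.1.4–9.1.5 (level curves of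
`P′/P`). -/
def TopLinkOrBaseLawQ (θ : ℝ) : Prop :=
  ∀ (η : ℝ) (f : ℂ → ℂ) (x₀ s hmax R Hs : ℝ) (B : ℕ), EngineHyps5 2 η f x₀ s hmax R Hs B → ∀ (j : ℕ) (a : ℂ),
    iteratedDeriv j f a = 0 → 0 < a.im → NoTallerToucher f j a → ¬ JensenIsolated f j a → iteratedDeriv (j + 1) f a ≠ 0 →
    (∃ a' : ℂ, iteratedDeriv j f a' = 0 ∧ (1 - θ) * a.im ≤ a'.im ∧ a'.im ≤ a.im ∧ 0 < a'.im ∧ |a.re - a'.re| ≤ a.im + a'.im ∧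
        HalfLink₂ f j a a') ∨
      (∃ x : ℝ, |x - a.re| ≤ a.im ∧ NLEventOf f j x)

/-- (K) the link-only law is the first alternative. -/
theorem topLinkOrBaseLaw_of_topLinkLawTol {θ : ℝ} (hL : TopLinkLawTolQ θ) : TopLinkOrBaseLawQ θ :=
  fun η f x₀ s hmax R Hs B hE j a ha hapos hN hJ hda => Or.inl (hL η f x₀ s hmax R Hs B hE j a ha hapos hN hJ hda)

/-- (K, bookkeeping) part N's law is contained in it (`a' := a`, first alternative; that law is dead as typed by NEG 16 — containment only). -/
theorem topLinkOrBaseLaw_of_topLinkLaw {θ : ℝ} (hθ : 0 ≤ θ) (hL : TopLinkLawQ) : TopLinkOrBaseLawQ θ := by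
  intro η f x₀ s hmax R Hs B hE j a ha hapos hN hJ hda
  refine Or.inl ⟨a, ha, by nlinarith, le_rfl, hapos, ?_, halfLink₂_of_halfLink a (hL η f x₀ s hmax R Hs B hE j a ha hapos hN hJ hda)⟩
  rw [sub_self, abs_zero]; linarith

/-- ★★ (K) THE LINK-OR-BASE LAW PAYS REGISTRY STUB 1′: `TopLinkOrBaseLawQ θ → TopPinningTol θ` for every `θ ≥ 0` (isolated tops by IsoB
`pinning_of_jensenIsolated'`; a multiple top is its own child; otherwise the law's partner and `pinning_of_halfLink₂`, or the base event pins `a`). -/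
theorem topPinningTol_of_topLinkOrBaseLaw {θ : ℝ} (hθ : 0 ≤ θ) (hL : TopLinkOrBaseLawQ θ) : TopPinningTol θ := by
  intro η f x₀ s hmax R Hs B hE j a ha hapos hN
  have hself : PinnedTopAt f j a → ∃ a' : ℂ, iteratedDeriv j f a' = 0 ∧ (1 - θ) * a.im ≤ a'.im ∧ a'.im ≤ a.im ∧
      |a.re - a'.re| ≤ a.im + a'.im ∧ PinnedTopAt f j a' := fun h =>
    ⟨a, ha, by nlinarith, le_rfl, by rw [sub_self, abs_zero]; linarith, h⟩
  by_cases hJ : JensenIsolated f j a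
  · exact hself (pinning_of_jensenIsolated' hE ha hapos hJ)
  by_cases hda : iteratedDeriv (j + 1) f a = 0
  · exact hself (Or.inl ⟨a, hda, hapos.ne', by unfold NestedStep; nlinarith [sq_nonneg a.im]⟩)
  rcases hL η f x₀ s hmax R Hs B hE j a ha hapos hN hJ hda with ⟨a', ha', hlo, hhi, ha'pos, htouch, hlink⟩ | hNL
  · rcases pinning_of_halfLink₂ hE ha hapos hda ha'pos.le hlink with h | h
    · exact hself h
    · exact ⟨a', ha', hlo, hhi, htouch, h⟩
  · exact hself (Or.inr hNL)

/-- ★★ … in particular at the registry's θ = 1/10: `TopLinkOrBaseLawQ (1/10) → TopPinningTol (1/10)` (= stub 1′ of `Lines/trkD_v14qP.lean`). -/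
theorem stub1'_of_topLinkOrBaseLaw (hL : TopLinkOrBaseLawQ (1 / 10)) : TopPinningTol (1 / 10) :=
  topPinningTol_of_topLinkOrBaseLaw (by norm_num) hL

end RhW08.Lens1LinkTol

end
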